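import Literature.NumberTheory.Transcendental.ThetaSplitSubgroups
import Literature.NumberTheory.Transcendental.ThetaTransvection
import HarnessLib

/-!
# Every connected algebraic subgroup of `M_κ` has a `Θ`-definable preimage

Topic: `Literature/NumberTheory/Transcendental`. A brick of the discharge of the named fact
`Literature.NumberTheory.Transcendental.philippon1986_std` (classification of the obstruction
subgroups of Philippon's zero estimate on `M_κ = 𝔾ₘ^β × P_κ`, general number of elliptic factors):
for EVERY datum `K = (A, C, Ξ)` of a connected algebraic subgroup `G'` (`GaGmE.Std.SubgroupDataC`)
the preimage `exp⁻¹(G') = Lie G' + ker` (`GaGmE.Std.preimageSubgroup`) is the common zero set of a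
set of theta forms (`GaGmE.Std.thetaDefinable_preimageSubgroup`), hence contains the closure
`Z(𝔍(Lie G'))` of its Lie algebra in any theta model (`zeroSet_vanishing_tangent_subset_preimageSubgroup`).

Reduction to the split case of `ThetaSplitSubgroups.lean` (`C = span{e_b : b ∈ S}`) by integer
changes of the `E`-coordinates:

* the elementary operations — the sign change `z'_{b₀} ↦ -z'_{b₀}` (`ThetaMorphic.flipMap`,
  `flipKappa`) and the transvection `z'_{b₁} ↦ z'_{b₁} + z'_{b₂}` (`ThetaTransvection.tvMap`,
  `tvKappa`) — are `Θ`-morphic isomorphisms `M_κ ≅ M_{κ'}`; they carry `K` to the datum `K'` with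
  `C' = C ∘ U⁻¹` (row operations `flipRow`, `tvRow`), `Lie` to `Lie`, `ker` to `ker` (`η` is
  `ℤ`-linear), hence `exp⁻¹(G'_K)` onto `exp⁻¹(G'_{K'})` (`preimage_*_preimageSubgroup`), and
  definability pulls back (`ThetaDefinable.preimage`);
* **Euclid** (`exists_split_step`): a non-zero integer vector of `C` supported off the already
  split coordinates `S` is reduced to a multiple of some `e_{b₀}`, `b₀ ∉ S`, by operations among
  its support (induction on `∑ |c_b|`: subtract the smaller entry from the larger after adjusting
  the sign), keeping `e_b ∈ C` for `b ∈ S`;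
* induction on `dim C - |S|` (`thetaDefinable_preimageSubgroup`).

Everything is PROVED; the only definitions are the row operations and the transported data.

## References

* Yu. V. Nesterenko, P. Philippon (eds.), *Introduction to Algebraic Independence Theory*,
  LNM 1752, Springer 2001, Ch. 11 (D. Roy), Thm. 4.1. [NesterenkoPhilippon2001]
* D. Bertrand, P. Philippon, *Sous-groupes algébriques de groupes algébriques commutatifs*,
  Illinois J. Math. 32 (1988), 263–280. [folklore]
-/

noncomputable section

open Complex MvPolynomial Module
open scoped PeriodPair

namespace Literature.NumberTheory.Transcendental

namespace GaGmE

namespace Std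

variable {β γ δ : Type} [Fintype β] [Fintype γ] [Fintype δ] [DecidableEq γ]
variable (L : PeriodPair)

/-! ### Row operations -/

/-- The sign change of the coordinate `b₀` of a row vector (any scalars). [folklore] -/
def flipRow (R : Type*) [CommRing R] (b₀ : γ) : (γ → R) ≃ₗ[R] (γ → R) where
  toFun c := Function.update c b₀ (-c b₀)
  invFun c := Function.update c b₀ (-c b₀)
  map_add' c c' := by
    funext b; by_cases hb : b = b₀
    · subst hb; simp; ring
    · simp [hb]
  map_smul' a c := by
    funext b; by_cases hb : b = b₀
    · subst hb; simp
    · simp [hb]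
  left_inv c := by
    funext b; by_cases hb : b = b₀
    · subst hb; simp
    · simp [hb]
  right_inv c := by
    funext b; by_cases hb : b = b₀
    · subst hb; simp
    · simp [hb]

/-- The row operation dual to the transvection `z'_{b₁} ↦ z'_{b₁} + z'_{b₂}`:
`c_{b₂} ↦ c_{b₂} - c_{b₁}` (so that `⟨c', z'⟩ = ⟨c, z⟩`). [folklore] -/
def tvRow (R : Type*) [CommRing R] (b₁ b₂ : γ) (h12 : b₁ ≠ b₂) : (γ → R) ≃ₗ[R] (γ → R) where
  toFun c := Function.update c b₂ (c b₂ - c b₁)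
  invFun c := Function.update c b₂ (c b₂ + c b₁)
  map_add' c c' := by
    funext b; by_cases hb : b = b₂
    · subst hb; simp; ring
    · simp [hb]
  map_smul' a c := by
    funext b; by_cases hb : b = b₂
    · subst hb; simp; ring
    · simp [hb]
  left_inv c := by
    funext b; by_cases hb : b = b₂
    · subst hb; simp [h12]
    · simp [hb]
  right_inv c := by
    funext b; by_cases hb : b = b₂
    · subst hb; simp [h12]
    · simp [hb]

omit [Fintype β] [Fintype γ] [Fintype δ] in
/-- Formula. [folklore] -/
theorem flipRow_apply (R : Type*) [CommRing R] (b₀ : γ) (c : γ → R) (b : γ) :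
    flipRow R b₀ c b = if b = b₀ then -c b₀ else c b := by
  by_cases hb : b = b₀
  · subst hb; simp [flipRow]
  · simp [flipRow, hb]

omit [Fintype β] [Fintype γ] [Fintype δ] in
/-- Formula. [folklore] -/
theorem tvRow_apply (R : Type*) [CommRing R] {b₁ b₂ : γ} (h12 : b₁ ≠ b₂) (c : γ → R) (b : γ) :
    tvRow R b₁ b₂ h12 c b = if b = b₂ then c b₂ - c b₁ else c b := by
  by_cases hb : b = b₂
  · subst hb; simp [tvRow]
  · simp [tvRow, hb]

omit [Fintype β] [Fintype γ] [Fintype δ] in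
/-- The row operations commute with `ℚ → ℂ`. [folklore] -/
theorem flipRow_ratCast (b₀ : γ) (c : γ → ℚ) :
    flipRow ℂ b₀ (fun b => (c b : ℂ)) = fun b => ((flipRow ℚ b₀ c b : ℚ) : ℂ) := by
  funext b; rw [flipRow_apply, flipRow_apply]; split_ifs <;> push_cast <;> rfl

omit [Fintype β] [Fintype γ] [Fintype δ] in
/-- The row operations commute with `ℚ → ℂ`. [folklore] -/
theorem tvRow_ratCast {b₁ b₂ : γ} (h12 : b₁ ≠ b₂) (c : γ → ℚ) :
    tvRow ℂ b₁ b₂ h12 (fun b => (c b : ℂ)) = fun b => ((tvRow ℚ b₁ b₂ h12 c b : ℚ) : ℂ) := by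
  funext b; rw [tvRow_apply, tvRow_apply]; split_ifs <;> push_cast <;> rfl

omit [Fintype β] [Fintype γ] [Fintype δ] in
/-- The row operations commute with `ℤ → ℚ`. [folklore] -/
theorem flipRow_intCast (b₀ : γ) (c : γ → ℤ) :
    flipRow ℚ b₀ (fun b => (c b : ℚ)) = fun b => ((flipRow ℤ b₀ c b : ℤ) : ℚ) := by
  funext b; rw [flipRow_apply, flipRow_apply]; split_ifs <;> push_cast <;> rfl

omit [Fintype β] [Fintype γ] [Fintype δ] in
/-- The row operations commute with `ℤ → ℚ`. [folklore] -/
theorem tvRow_intCast {b₁ b₂ : γ} (h12 : b₁ ≠ b₂) (c : γ → ℤ) :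
    tvRow ℚ b₁ b₂ h12 (fun b => (c b : ℚ)) = fun b => ((tvRow ℤ b₁ b₂ h12 c b : ℤ) : ℚ) := by
  funext b; rw [tvRow_apply, tvRow_apply]; split_ifs <;> push_cast <;> rfl

omit [Fintype β] [Fintype δ] in
/-- **Duality for the flip**: `⟨flipRow c, flip z⟩ = ⟨c, z⟩`. [folklore] -/
theorem sum_flipRow_mul_flipMap (b₀ : γ) (c : γ → ℚ) (w : β ⊕ (γ ⊕ δ) → ℂ) :
    ∑ b, ((flipRow ℚ b₀ c b : ℚ) : ℂ) * flipMap b₀ w (iz b) = ∑ b, (c b : ℂ) * w (iz b) := by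
  refine Finset.sum_congr rfl fun b _ => ?_
  rw [flipRow_apply]
  by_cases hb : b = b₀
  · subst hb; rw [if_pos rfl, flipMap_iz_self]; push_cast; ring
  · rw [if_neg hb, flipMap_iz_of_ne hb]

omit [Fintype β] [Fintype δ] in
/-- **Duality for the transvection**: `⟨tvRow c, tv z⟩ = ⟨c, z⟩`. [folklore] -/
theorem sum_tvRow_mul_tvMap {b₁ b₂ : γ} (h12 : b₁ ≠ b₂) (c : γ → ℚ) (w : β ⊕ (γ ⊕ δ) → ℂ) :
    ∑ b, ((tvRow ℚ b₁ b₂ h12 c b : ℚ) : ℂ) * tvMap b₁ b₂ w (iz b) = ∑ b, (c b : ℂ) * w (iz b) := by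
  rw [sum_split2 h12, sum_split2 h12 (fun b => (c b : ℂ) * w (iz b))]
  have hrest : ∑ b ∈ rest b₁ b₂, ((tvRow ℚ b₁ b₂ h12 c b : ℚ) : ℂ) * tvMap b₁ b₂ w (iz b) =
      ∑ b ∈ rest b₁ b₂, (c b : ℂ) * w (iz b) := by
    refine Finset.sum_congr rfl fun b hb => ?_
    obtain ⟨hb1, hb2⟩ := mem_rest_iff.mp hb
    rw [tvRow_apply, if_neg hb2, tvMap_iz_of_ne hb1]
  rw [hrest, tvRow_apply, tvRow_apply, if_neg h12, if_pos rfl, tvMap_iz_fst, tvMap_iz_of_ne h12.symm]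
  push_cast
  ring

/-! ### Transport of a datum along a row operation -/

omit [Fintype β] [Fintype γ] [Fintype δ] [DecidableEq γ] in
/-- Complex combinations of rational vectors transform with the row operation. [folklore] -/
theorem map_span_ratCast (f : (γ → ℚ) ≃ₗ[ℚ] (γ → ℚ)) (g : (γ → ℂ) ≃ₗ[ℂ] (γ → ℂ))
    (hfg : ∀ c : γ → ℚ, g (fun b => (c b : ℂ)) = fun b => ((f c b : ℚ) : ℂ)) (C : Submodule ℚ (γ → ℚ)) :
    (Submodule.span ℂ ((fun c : γ → ℚ => fun b => (c b : ℂ)) '' (C : Set (γ → ℚ)))).map (g : (γ → ℂ) →ₗ[ℂ] (γ → ℂ)) =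
      Submodule.span ℂ ((fun c : γ → ℚ => fun b => (c b : ℂ)) '' (C.map (f : (γ → ℚ) →ₗ[ℚ] (γ → ℚ)) : Set (γ → ℚ))) := by
  rw [← Submodule.span_image]
  congr 1
  ext v
  simp only [Set.mem_image, SetLike.mem_coe, Submodule.mem_map, LinearEquiv.coe_coe]
  constructor
  · rintro ⟨_, ⟨c, hc, rfl⟩, rfl⟩
    exact ⟨f c, ⟨c, hc, rfl⟩, (hfg c).symm⟩
  · rintro ⟨_, ⟨c, hc, rfl⟩, rfl⟩
    exact ⟨_, ⟨c, hc, rfl⟩, hfg c⟩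

omit [Fintype β] [Fintype γ] [Fintype δ] [DecidableEq γ] in
/-- A member of a span is carried into the image span. [folklore] -/
theorem mem_span_map_of_mem (f : (γ → ℚ) ≃ₗ[ℚ] (γ → ℚ)) (g : (γ → ℂ) ≃ₗ[ℂ] (γ → ℂ))
    (hfg : ∀ c : γ → ℚ, g (fun b => (c b : ℂ)) = fun b => ((f c b : ℚ) : ℂ)) (C : Submodule ℚ (γ → ℚ))
    {v : γ → ℂ} (hv : v ∈ Submodule.span ℂ ((fun c : γ → ℚ => fun b => (c b : ℂ)) '' (C : Set (γ → ℚ)))) :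
    g v ∈ Submodule.span ℂ ((fun c : γ → ℚ => fun b => (c b : ℂ)) '' (C.map (f : (γ → ℚ) →ₗ[ℚ] (γ → ℚ)) : Set (γ → ℚ))) := by
  rw [← map_span_ratCast f g hfg C]
  exact Submodule.mem_map_of_mem hv

variable (κM : δ → γ → Kbar)

/-- **The datum transported along the flip** of the coordinate `b₀` (for the flipped `κ`). [folklore] -/
def flipData (b₀ : γ) (K : SubgroupDataC β γ δ κM) : SubgroupDataC β γ δ (flipKappa κM b₀) where
  A := K.A
  C := K.C.map (flipRow ℚ b₀ : (γ → ℚ) →ₗ[ℚ] (γ → ℚ))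
  Ξ := K.Ξ
  compat ξ hξ := by
    have hv := mem_span_map_of_mem (flipRow ℚ b₀) (flipRow ℂ b₀) (flipRow_ratCast b₀) K.C (K.compat ξ hξ)
    convert hv using 1
    funext b
    change ∑ e, ξ e * ((flipKappa κM b₀ e b : Kbar) : ℂ) = flipRow ℂ b₀ (fun b => ∑ e, ξ e * (κM e b : ℂ)) b
    rw [flipRow_apply]
    by_cases hb : b = b₀
    · subst hb; simp [flipKappa, Finset.sum_neg_distrib, mul_neg]
    · simp [flipKappa, hb]

/-- **The datum transported along the transvection** `z'_{b₁} ↦ z'_{b₁} + z'_{b₂}`. [folklore] -/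
def tvData {b₁ b₂ : γ} (h12 : b₁ ≠ b₂) (K : SubgroupDataC β γ δ κM) : SubgroupDataC β γ δ (tvKappa κM b₁ b₂) where
  A := K.A
  C := K.C.map (tvRow ℚ b₁ b₂ h12 : (γ → ℚ) →ₗ[ℚ] (γ → ℚ))
  Ξ := K.Ξ
  compat ξ hξ := by
    have hv := mem_span_map_of_mem (tvRow ℚ b₁ b₂ h12) (tvRow ℂ b₁ b₂ h12) (tvRow_ratCast h12) K.C (K.compat ξ hξ)
    convert hv using 1
    funext b
    change ∑ e, ξ e * ((tvKappa κM b₁ b₂ e b : Kbar) : ℂ) = tvRow ℂ b₁ b₂ h12 (fun b => ∑ e, ξ e * (κM e b : ℂ)) b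
    rw [tvRow_apply]
    by_cases hb : b = b₂
    · subst hb; simp [tvKappa, mul_sub, Finset.sum_sub_distrib]
    · simp [tvKappa, hb]

/-! ### Transport of `Lie G'` and of `ker` -/

/-- **`Lie` is carried to `Lie`** by the flip. [folklore] -/
theorem mem_tangent_flipData_iff (b₀ : γ) (K : SubgroupDataC β γ δ κM) (w : β ⊕ (γ ⊕ δ) → ℂ) :
    flipMap b₀ w ∈ (flipData κM b₀ K).tangent ↔ w ∈ K.tangent := by
  rw [SubgroupDataC.mem_tangent_iff, SubgroupDataC.mem_tangent_iff]
  simp only [flipMap_iy, flipMap_is]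
  refine and_congr Iff.rfl (and_congr ?_ Iff.rfl)
  change (∀ c ∈ K.C.map (flipRow ℚ b₀ : (γ → ℚ) →ₗ[ℚ] (γ → ℚ)), _) ↔ _
  constructor
  · intro h c hc
    have := h _ (Submodule.mem_map_of_mem hc)
    rwa [LinearEquiv.coe_coe, sum_flipRow_mul_flipMap] at this
  · intro h c' hc'
    obtain ⟨c, hc, rfl⟩ := Submodule.mem_map.mp hc'
    rw [LinearEquiv.coe_coe, sum_flipRow_mul_flipMap]
    exact h c hc

/-- **`Lie` is carried to `Lie`** by the transvection. [folklore] -/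
theorem mem_tangent_tvData_iff {b₁ b₂ : γ} (h12 : b₁ ≠ b₂) (K : SubgroupDataC β γ δ κM) (w : β ⊕ (γ ⊕ δ) → ℂ) :
    tvMap b₁ b₂ w ∈ (tvData κM h12 K).tangent ↔ w ∈ K.tangent := by
  rw [SubgroupDataC.mem_tangent_iff, SubgroupDataC.mem_tangent_iff]
  simp only [tvMap_iy, tvMap_is]
  refine and_congr Iff.rfl (and_congr ?_ Iff.rfl)
  change (∀ c ∈ K.C.map (tvRow ℚ b₁ b₂ h12 : (γ → ℚ) →ₗ[ℚ] (γ → ℚ)), _) ↔ _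
  constructor
  · intro h c hc
    have := h _ (Submodule.mem_map_of_mem hc)
    rwa [LinearEquiv.coe_coe, sum_tvRow_mul_tvMap h12] at this
  · intro h c' hc'
    obtain ⟨c, hc, rfl⟩ := Submodule.mem_map.mp hc'
    rw [LinearEquiv.coe_coe, sum_tvRow_mul_tvMap h12]
    exact h c hc

omit [Fintype β] [Fintype δ] in
/-- **`ker` is carried into `ker`** by the flip (`η` is odd on `Λ`). [folklore] -/
theorem flipMap_mem_ker (b₀ : γ) {k : β ⊕ (γ ⊕ δ) → ℂ} (hk : k ∈ ker L κM) :
    flipMap b₀ k ∈ ker L (flipKappa κM b₀) := by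
  obtain ⟨hy, m, n, hz, hs⟩ := hk
  refine ⟨fun j => by simpa using hy j, flipRow ℤ b₀ m, flipRow ℤ b₀ n, fun b => ?_, fun e => ?_⟩
  · rw [flipRow_apply, flipRow_apply]
    by_cases hb : b = b₀
    · subst hb; rw [if_pos rfl, if_pos rfl, flipMap_iz_self, hz]; push_cast; ring
    · rw [if_neg hb, if_neg hb, flipMap_iz_of_ne hb, hz]
  · rw [flipMap_is, hs e]
    refine Finset.sum_congr rfl fun b _ => ?_
    rw [flipRow_apply, flipRow_apply]
    by_cases hb : b = b₀
    · subst hb; simp [flipKappa]; ring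
    · simp [flipKappa, hb]

omit [Fintype β] [Fintype δ] in
/-- **`ker` is carried into `ker`** by the transvection (`η` is additive on `Λ`). [folklore] -/
theorem tvMap_mem_ker {b₁ b₂ : γ} (h12 : b₁ ≠ b₂) {k : β ⊕ (γ ⊕ δ) → ℂ} (hk : k ∈ ker L κM) :
    tvMap b₁ b₂ k ∈ ker L (tvKappa κM b₁ b₂) := by
  obtain ⟨hy, m, n, hz, hs⟩ := hk
  refine ⟨fun j => by simpa using hy j, Function.update m b₁ (m b₁ + m b₂), Function.update n b₁ (n b₁ + n b₂),
    fun b => ?_, fun e => ?_⟩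
  · by_cases hb : b = b₁
    · subst hb; rw [tvMap_iz_fst, Function.update_self, Function.update_self, hz, hz]; push_cast; ring
    · rw [tvMap_iz_of_ne hb, Function.update_of_ne hb, Function.update_of_ne hb, hz]
  · rw [tvMap_is, hs e, sum_split2 h12, sum_split2 h12 (fun b => ((tvKappa κM b₁ b₂ e b : Kbar) : ℂ) * _)]
    have hrest : ∑ b ∈ rest b₁ b₂, ((tvKappa κM b₁ b₂ e b : Kbar) : ℂ) *
        ((Function.update m b₁ (m b₁ + m b₂) b : ℂ) * L.η₁ + (Function.update n b₁ (n b₁ + n b₂) b : ℂ) * L.η₂) =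
        ∑ b ∈ rest b₁ b₂, (κM e b : ℂ) * ((m b : ℂ) * L.η₁ + (n b : ℂ) * L.η₂) := by
      refine Finset.sum_congr rfl fun b hb => ?_
      obtain ⟨hb1, hb2⟩ := mem_rest_iff.mp hb
      rw [Function.update_of_ne hb1, Function.update_of_ne hb1]
      simp [tvKappa, hb2]
    rw [hrest, Function.update_self, Function.update_self, Function.update_of_ne h12.symm,
      Function.update_of_ne h12.symm]
    have hk1 : ((tvKappa κM b₁ b₂ e b₁ : Kbar) : ℂ) = κM e b₁ := by simp [tvKappa, h12]
    have hk2 : ((tvKappa κM b₁ b₂ e b₂ : Kbar) : ℂ) = (κM e b₂ : ℂ) - κM e b₁ := by simp [tvKappa]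
    rw [hk1, hk2]
    push_cast
    ring

/-! ### Transport of the preimage `Lie G' + ker` -/

omit [DecidableEq γ] in
/-- **Image of a preimage subgroup under an additive bijection carrying `Lie` to `Lie` and `ker`
to `ker`.** [folklore] -/
theorem image_preimageSubgroup_eq {κM' : δ → γ → Kbar} (Ψ : (β ⊕ (γ ⊕ δ) → ℂ) →+ (β ⊕ (γ ⊕ δ) → ℂ))
    (K : SubgroupDataC β γ δ κM) (K' : SubgroupDataC β γ δ κM')
    (htan : (Ψ : (β ⊕ (γ ⊕ δ) → ℂ) → _) '' (K.tangent : Set (β ⊕ (γ ⊕ δ) → ℂ)) = K'.tangent)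
    (hker : (Ψ : (β ⊕ (γ ⊕ δ) → ℂ) → _) '' ker L κM = ker L κM') :
    (Ψ : (β ⊕ (γ ⊕ δ) → ℂ) → _) '' (preimageSubgroup L κM K : Set (β ⊕ (γ ⊕ δ) → ℂ)) =
      preimageSubgroup L κM' K' := by
  have h1 : (K.tangent.toAddSubgroup).map Ψ = K'.tangent.toAddSubgroup := by
    ext v
    rw [AddSubgroup.mem_map]
    change (∃ x ∈ (K.tangent : Set _), Ψ x = v) ↔ v ∈ (K'.tangent : Set _)
    rw [← htan, Set.mem_image]
  have h2 : (AddSubgroup.closure (ker L κM)).map Ψ = AddSubgroup.closure (ker L κM') := by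
    rw [AddMonoidHom.map_closure, hker]
  rw [← AddSubgroup.coe_map, preimageSubgroup, AddSubgroup.map_sup, h1, h2]
  rfl

omit [DecidableEq γ] in
/-- **Preimage form**: for `Ψ` injective as well, `Ψ⁻¹(exp⁻¹ G'_{K'}) = exp⁻¹ G'_K`. [folklore] -/
theorem preimage_preimageSubgroup_eq {κM' : δ → γ → Kbar} (Ψ : (β ⊕ (γ ⊕ δ) → ℂ) →+ (β ⊕ (γ ⊕ δ) → ℂ))
    (hΨ : Function.Injective Ψ) (K : SubgroupDataC β γ δ κM) (K' : SubgroupDataC β γ δ κM')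
    (htan : (Ψ : (β ⊕ (γ ⊕ δ) → ℂ) → _) '' (K.tangent : Set (β ⊕ (γ ⊕ δ) → ℂ)) = K'.tangent)
    (hker : (Ψ : (β ⊕ (γ ⊕ δ) → ℂ) → _) '' ker L κM = ker L κM') :
    (Ψ : (β ⊕ (γ ⊕ δ) → ℂ) → _) ⁻¹' (preimageSubgroup L κM' K' : Set (β ⊕ (γ ⊕ δ) → ℂ)) =
      preimageSubgroup L κM K := by
  rw [← image_preimageSubgroup_eq L κM Ψ K K' htan hker, Set.preimage_image_eq _ hΨ]

/-- The flip as an additive map. [folklore] -/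
def flipHom (b₀ : γ) : (β ⊕ (γ ⊕ δ) → ℂ) →+ (β ⊕ (γ ⊕ δ) → ℂ) where
  toFun := flipMap b₀
  map_zero' := by
    funext k; rcases k with j | b | e
    · exact flipMap_iy b₀ 0 j
    · by_cases hb : b = b₀
      · subst hb; change flipMap b 0 (iz b) = 0; simp
      · change flipMap b₀ 0 (iz b) = 0; rw [flipMap_iz_of_ne hb]; rfl
    · exact flipMap_is b₀ 0 e
  map_add' v w := by
    funext k; rcases k with j | b | e
    · change flipMap b₀ (v + w) (iy j) = flipMap b₀ v (iy j) + flipMap b₀ w (iy j); simp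
    · by_cases hb : b = b₀
      · subst hb
        change flipMap b (v + w) (iz b) = flipMap b v (iz b) + flipMap b w (iz b)
        simp; ring
      · change flipMap b₀ (v + w) (iz b) = flipMap b₀ v (iz b) + flipMap b₀ w (iz b)
        simp [flipMap_iz_of_ne hb]
    · change flipMap b₀ (v + w) (is e) = flipMap b₀ v (is e) + flipMap b₀ w (is e); simp

/-- The transvection as an additive map. [folklore] -/
def tvHom (b₁ b₂ : γ) : (β ⊕ (γ ⊕ δ) → ℂ) →+ (β ⊕ (γ ⊕ δ) → ℂ) where
  toFun := tvMap b₁ b₂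
  map_zero' := by
    funext k; rcases k with j | b | e
    · exact tvMap_iy 0 j
    · by_cases hb : b = b₁
      · subst hb; change tvMap b b₂ 0 (iz b) = 0; simp
      · change tvMap b₁ b₂ 0 (iz b) = 0; rw [tvMap_iz_of_ne hb]; rfl
    · exact tvMap_is 0 e
  map_add' v w := by
    funext k; rcases k with j | b | e
    · change tvMap b₁ b₂ (v + w) (iy j) = tvMap b₁ b₂ v (iy j) + tvMap b₁ b₂ w (iy j); simp
    · by_cases hb : b = b₁
      · subst hb
        change tvMap b b₂ (v + w) (iz b) = tvMap b b₂ v (iz b) + tvMap b b₂ w (iz b)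
        simp; ring
      · change tvMap b₁ b₂ (v + w) (iz b) = tvMap b₁ b₂ v (iz b) + tvMap b₁ b₂ w (iz b)
        simp [tvMap_iz_of_ne hb]
    · change tvMap b₁ b₂ (v + w) (is e) = tvMap b₁ b₂ v (is e) + tvMap b₁ b₂ w (is e); simp

/-- The inverse transvection `z'_{b₁} ↦ z'_{b₁} - z'_{b₂}`. [folklore] -/
def tvInv (b₁ b₂ : γ) (w : β ⊕ (γ ⊕ δ) → ℂ) : β ⊕ (γ ⊕ δ) → ℂ :=
  coords (fun j => w (iy j)) (fun b => if b = b₁ then w (iz b₁) - w (iz b₂) else w (iz b)) fun e => w (is e)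

omit [Fintype β] [Fintype γ] [Fintype δ] in
/-- `tvInv` is a left inverse of `tvMap`. [folklore] -/
theorem tvInv_tvMap {b₁ b₂ : γ} (h12 : b₁ ≠ b₂) (w : β ⊕ (γ ⊕ δ) → ℂ) : tvInv b₁ b₂ (tvMap b₁ b₂ w) = w := by
  funext k; rcases k with j | b | e
  · change tvInv b₁ b₂ (tvMap b₁ b₂ w) (iy j) = w (iy j); simp [tvInv]
  · change tvInv b₁ b₂ (tvMap b₁ b₂ w) (iz b) = w (iz b)
    by_cases hb : b = b₁
    · subst hb; simp [tvInv, tvMap_iz_of_ne h12.symm]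
    · simp [tvInv, hb, tvMap_iz_of_ne hb]
  · change tvInv b₁ b₂ (tvMap b₁ b₂ w) (is e) = w (is e); simp [tvInv]

omit [Fintype β] [Fintype γ] [Fintype δ] in
/-- `tvInv` is a right inverse of `tvMap`. [folklore] -/
theorem tvMap_tvInv {b₁ b₂ : γ} (h12 : b₁ ≠ b₂) (w : β ⊕ (γ ⊕ δ) → ℂ) : tvMap b₁ b₂ (tvInv b₁ b₂ w) = w := by
  funext k; rcases k with j | b | e
  · change tvMap b₁ b₂ (tvInv b₁ b₂ w) (iy j) = w (iy j); simp [tvInv]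
  · change tvMap b₁ b₂ (tvInv b₁ b₂ w) (iz b) = w (iz b)
    by_cases hb : b = b₁
    · subst hb; rw [tvMap_iz_fst]; simp [tvInv, h12.symm]
    · rw [tvMap_iz_of_ne hb]; simp [tvInv, hb]
  · change tvMap b₁ b₂ (tvInv b₁ b₂ w) (is e) = w (is e); simp [tvInv]

/-- **The flip carries `exp⁻¹(G'_K)` onto `exp⁻¹(G'_{K'})`** (preimage form). [folklore] -/
theorem preimage_flipMap_preimageSubgroup (b₀ : γ) (K : SubgroupDataC β γ δ κM) :
    flipMap b₀ ⁻¹' (preimageSubgroup L (flipKappa κM b₀) (flipData κM b₀ K) : Set (β ⊕ (γ ⊕ δ) → ℂ)) =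
      preimageSubgroup L κM K := by
  have hinv : ∀ w : β ⊕ (γ ⊕ δ) → ℂ, flipMap b₀ (flipMap b₀ w) = w := flipMap_flipMap b₀
  refine preimage_preimageSubgroup_eq L κM (flipHom b₀) (fun v w h => by
    have := congrArg (flipMap b₀) h; simpa [flipHom, hinv] using this) K _ ?_ ?_
  · ext v
    simp only [Set.mem_image, SetLike.mem_coe]
    constructor
    · rintro ⟨w, hw, rfl⟩; exact (mem_tangent_flipData_iff κM b₀ K w).mpr hw
    · intro hv
      refine ⟨flipMap b₀ v, ?_, hinv v⟩
      have := (mem_tangent_flipData_iff κM b₀ K (flipMap b₀ v)).mp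
      rw [hinv] at this
      exact this hv
  · ext v
    simp only [Set.mem_image]
    constructor
    · rintro ⟨w, hw, rfl⟩; exact flipMap_mem_ker L κM b₀ hw
    · intro hv
      refine ⟨flipMap b₀ v, ?_, hinv v⟩
      have := flipMap_mem_ker L (flipKappa κM b₀) b₀ hv
      rwa [flipKappa_flipKappa] at this

/-- **The transvection carries `exp⁻¹(G'_K)` onto `exp⁻¹(G'_{K'})`** (preimage form). [folklore] -/
theorem preimage_tvMap_preimageSubgroup {b₁ b₂ : γ} (h12 : b₁ ≠ b₂) (K : SubgroupDataC β γ δ κM) :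
    tvMap b₁ b₂ ⁻¹' (preimageSubgroup L (tvKappa κM b₁ b₂) (tvData κM h12 K) : Set (β ⊕ (γ ⊕ δ) → ℂ)) =
      preimageSubgroup L κM K := by
  refine preimage_preimageSubgroup_eq L κM (tvHom b₁ b₂) (fun v w h => by
    have := congrArg (tvInv b₁ b₂) h; simpa [tvHom, tvInv_tvMap h12] using this) K _ ?_ ?_
  · ext v
    simp only [Set.mem_image, SetLike.mem_coe]
    constructor
    · rintro ⟨w, hw, rfl⟩; exact (mem_tangent_tvData_iff κM h12 K w).mpr hw
    · intro hv
      refine ⟨tvInv b₁ b₂ v, ?_, tvMap_tvInv h12 v⟩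
      have := (mem_tangent_tvData_iff κM h12 K (tvInv b₁ b₂ v)).mp
      rw [tvMap_tvInv h12] at this
      exact this hv
  · ext v
    simp only [Set.mem_image]
    constructor
    · rintro ⟨w, hw, rfl⟩; exact tvMap_mem_ker L κM h12 hw
    · intro hv
      refine ⟨tvInv b₁ b₂ v, ?_, tvMap_tvInv h12 v⟩
      -- the inverse transvection carries `ker'` back into `ker`
      obtain ⟨hy, m, n, hz, hs⟩ := hv
      refine ⟨fun j => by simpa [tvInv] using hy j, Function.update m b₁ (m b₁ - m b₂),
        Function.update n b₁ (n b₁ - n b₂), fun b => ?_, fun e => ?_⟩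
      · by_cases hb : b = b₁
        · subst hb
          simp only [tvInv, coords_iz, Function.update_self, hz]
          push_cast; ring
        · simp only [tvInv, coords_iz, if_neg hb, Function.update_of_ne hb, hz]
      · simp only [tvInv, coords_is, hs e]
        rw [sum_split2 h12, sum_split2 h12 (fun b => (κM e b : ℂ) * _)]
        have hrest : ∑ b ∈ rest b₁ b₂, ((tvKappa κM b₁ b₂ e b : Kbar) : ℂ) * ((m b : ℂ) * L.η₁ + (n b : ℂ) * L.η₂) =
            ∑ b ∈ rest b₁ b₂, (κM e b : ℂ) *
              ((Function.update m b₁ (m b₁ - m b₂) b : ℂ) * L.η₁ + (Function.update n b₁ (n b₁ - n b₂) b : ℂ) * L.η₂) := by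
          refine Finset.sum_congr rfl fun b hb => ?_
          obtain ⟨hb1, hb2⟩ := mem_rest_iff.mp hb
          rw [Function.update_of_ne hb1, Function.update_of_ne hb1]
          simp [tvKappa, hb2]
        rw [hrest, Function.update_self, Function.update_self, Function.update_of_ne h12.symm,
          Function.update_of_ne h12.symm]
        have hk1 : ((tvKappa κM b₁ b₂ e b₁ : Kbar) : ℂ) = κM e b₁ := by simp [tvKappa, h12]
        have hk2 : ((tvKappa κM b₁ b₂ e b₂ : Kbar) : ℂ) = (κM e b₂ : ℂ) - κM e b₁ := by simp [tvKappa]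
        rw [hk1, hk2]
        push_cast
        ring

/-! ### Definability is carried back along the operations -/

/-- **Flip step**: definability of `exp⁻¹(G'_{K'})` in `M_{κ'}` gives that of `exp⁻¹(G'_K)` in `M_κ`. [folklore] -/
theorem thetaDefinable_of_flip (b₀ : γ) (K : SubgroupDataC β γ δ κM)
    (h : ThetaDefinable L (flipKappa κM b₀) (preimageSubgroup L (flipKappa κM b₀) (flipData κM b₀ K) : Set (β ⊕ (γ ⊕ δ) → ℂ))) :
    ThetaDefinable L κM (preimageSubgroup L κM K : Set (β ⊕ (γ ⊕ δ) → ℂ)) := by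
  have := h.preimage L κM (flipKappa κM b₀) (isThetaMorphic_flip L κM b₀)
  rwa [preimage_flipMap_preimageSubgroup] at this

/-- **Transvection step.** [folklore] -/
theorem thetaDefinable_of_tv {b₁ b₂ : γ} (h12 : b₁ ≠ b₂) (K : SubgroupDataC β γ δ κM)
    (h : ThetaDefinable L (tvKappa κM b₁ b₂) (preimageSubgroup L (tvKappa κM b₁ b₂) (tvData κM h12 K) : Set (β ⊕ (γ ⊕ δ) → ℂ))) :
    ThetaDefinable L κM (preimageSubgroup L κM K : Set (β ⊕ (γ ⊕ δ) → ℂ)) := by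
  have := h.preimage L κM (tvKappa κM b₁ b₂) (isThetaMorphic_transvection L κM h12)
  rwa [preimage_tvMap_preimageSubgroup] at this

end Std

end GaGmE

end Literature.NumberTheory.Transcendental

end
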